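import Mathlib
import Summits.Langlands.Langlands.Theorems.CapacityClassicalityIntegralOverconvergentIsCongruenceStubKatzSturm

/-!
# Crux `HilbertIntegralOverconvergentIsCongruence` (stmt-Langlands-8485), line `Sketch-ideate-r1-k1`:
# the Sturm–Schwarz `p`-adic lemma at the cusp with an ABSTRACT Sturm line

Companion of `CapacityClassicalityHilbertIntegralOverconvergentIsCongruenceStubShadowMain.lean` (same
three-line Katz-truncation argument, same elementary inputs as hypotheses; the only import beyond Mathlib is
the sibling line's `CapacityClassicality.norm_coeff_pow_le_one`, powers of an integral series are integral).  The only
change: the sup-norm Sturm principle enters with an arbitrary line `L : ℤ → ℕ` ("coefficients of index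
`< L k'` small ⇒ all small" for classical forms of weight `k'` on `Γ₁(N)`), and the conclusion is the
sharper `‖g_m‖ ≤ C · p^{-r(M+1)}` for every `M` with `L (k + M(p-1)) ≤ m`.  This is the form the
reshaped line consumes: with `L k' = ⌊(k'+12)·[SL₂(ℤ):Γ₁(N)]/12⌋` the hypothesis follows from the
sup-norm Sturm bound for CUSP forms (Deligne–Serre integral lattice, PROVED in the tree, + Sturm's
congruence mod `p` over `ℤ`, the one named fact shared with the sibling crux
`IntegralOverconvergentIsCongruence`) by a `Δ`-twist; with `L k' = ⌊k'μ/12⌋ + 1` it is Sturm 1987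
Thm 1 in norm form (`IntegralSturmNormQ`).  Theorems only, no definitions.
-/

set_option linter.dupNamespace false

noncomputable section

open scoped MatrixGroups

namespace Summit.Langlands.Langlands.Theorems.HilbertIntegralOverconvergentIsCongruence

/-- **Sturm–Schwarz `p`-adic lemma at the cusp, `d = 1` shadow — general Sturm-line form.**
Fix `p ≥ 5` prime, `N`, `k`, `ι : ℚ̄_p ≃ ℂ` and an arbitrary "Sturm line" `L : ℤ → ℕ`.  Assume the
sup-norm Sturm principle at level `Γ₁(N)` along `ι` with that line (hypothesis `hSturm`: a classical
form of weight `k'` on `Γ₁(N)` whose `q`-coefficients of index `< L k'` have `ι⁻¹`-norm `≤ B` (`B ≥ 0`)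
has all coefficients of norm `≤ B` — e.g. `L k' = ⌊k'μ/12⌋ + 1` is Sturm 1987 Thm 1 in norm form, and
`L k' = ⌊(k'+12)μ/12⌋` is what the cusp-form version yields after a `Δ`-twist), the `p`-adic integrality of
`E_{p-1}` (`hE`), the ultrametric product rule (`hmul`), integrality of inverses (`hinv`) and that Katz
truncations are classical (`htrunc`).  Then a Katz surrogate `g = Σ_i ι⁻¹(c_i E_{p-1}^{-i})` with
`‖ι⁻¹ c_i‖ ≤ C p^{-ri}` vanishing to order `m` has `‖g_m‖ ≤ C p^{-r(M+1)}` (note the `+1`) for every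
`M` with `L (k + M(p-1)) ≤ m`. -/
theorem sturmSchwarzShadow_of_sturmLine (p : ℕ) [Fact p.Prime] (hp : 5 ≤ p) (N : ℕ) [NeZero N]
    (k : ℤ) (ι : PadicAlgCl p ≃+* ℂ) (L : ℤ → ℕ)
    (hSturm : ∀ (k' : ℤ) (F : ModularForm (CongruenceSubgroup.Gamma1 N) k') (B : ℝ), 0 ≤ B →
      (∀ n : ℕ, n < L k' →
        ‖ι.symm (PowerSeries.coeff n (UpperHalfPlane.qExpansion 1 ⇑F))‖ ≤ B) →
      ∀ n : ℕ, ‖ι.symm (PowerSeries.coeff n (UpperHalfPlane.qExpansion 1 ⇑F))‖ ≤ B)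
    (hE : ∀ n : ℕ, ‖ι.symm (PowerSeries.coeff n
      (UpperHalfPlane.qExpansion 1 ⇑(ModularForm.E (show 3 ≤ p - 1 by omega))))‖ ≤ 1)
    (hmul : ∀ (φ ψ : PowerSeries (PadicAlgCl p)) (A B : ℝ), 0 ≤ A → 0 ≤ B →
      (∀ n, ‖PowerSeries.coeff n φ‖ ≤ A) → (∀ n, ‖PowerSeries.coeff n ψ‖ ≤ B) →
      ∀ n, ‖PowerSeries.coeff n (φ * ψ)‖ ≤ A * B)
    (hinv : ∀ (φ : PowerSeries (PadicAlgCl p)),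
      PowerSeries.constantCoeff φ = 1 → (∀ n, ‖PowerSeries.coeff n φ‖ ≤ 1) →
      ∀ n : ℕ, ‖PowerSeries.coeff n φ⁻¹‖ ≤ 1)
    (htrunc : ∀ (c : ℕ → PowerSeries ℂ),
      (∀ i : ℕ, ∃ F : ModularForm (CongruenceSubgroup.Gamma1 N) (k + i * (p - 1 : ℕ)),
        c i = UpperHalfPlane.qExpansion 1 ⇑F) →
      ∀ M : ℕ, ∃ T : ModularForm (CongruenceSubgroup.Gamma1 N) (k + M * (p - 1 : ℕ)),
        UpperHalfPlane.qExpansion 1 ⇑T = ∑ i ∈ Finset.range (M + 1),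
          c i * (UpperHalfPlane.qExpansion 1 ⇑(ModularForm.E (show 3 ≤ p - 1 by omega))) ^ (M - i))
    (r C : ℝ) (c : ℕ → PowerSeries ℂ) (hr : 0 < r) (hC : 0 ≤ C)
    (hc : ∀ i : ℕ, ∃ F : ModularForm (CongruenceSubgroup.Gamma1 N) (k + i * (p - 1 : ℕ)),
        c i = UpperHalfPlane.qExpansion 1 ⇑F)
    (hbound : ∀ i n : ℕ, ‖ι.symm (PowerSeries.coeff n (c i))‖ ≤ C * (p : ℝ) ^ (-(r * i)))
    (g : ℕ → PadicAlgCl p)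
    (hg : ∀ n : ℕ, HasSum (fun i : ℕ ↦ ι.symm (PowerSeries.coeff n (c i *
        ((UpperHalfPlane.qExpansion 1 ⇑(ModularForm.E (show 3 ≤ p - 1 by omega)))⁻¹) ^ i)))
        (g n))
    (m M : ℕ) (hvan : ∀ n < m, g n = 0) (hline : L (k + M * (p - 1 : ℕ)) ≤ m) :
    ‖g m‖ ≤ C * (p : ℝ) ^ (-(r * (M + 1 : ℕ))) := by
  classical
  -- Notation: the Eisenstein `q`-expansion `qE` (constant term `1`), everything read in `ℚ̄_p` via `j`.
  set qE : PowerSeries ℂ := UpperHalfPlane.qExpansion 1 ⇑(ModularForm.E (show 3 ≤ p - 1 by omega))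
    with hqE_def
  set j : ℂ →+* PadicAlgCl p := ι.symm.toRingHom with hj_def
  have hj : ∀ x, j x = ι.symm x := fun x ↦ rfl
  have hpeven : Even (p - 1) := by
    have hodd : Odd p := (Fact.out : p.Prime).odd_of_ne_two (by omega)
    obtain ⟨t, ht⟩ := hodd
    exact ⟨t, by omega⟩
  have hqE0 : PowerSeries.constantCoeff qE = 1 := by
    rw [← PowerSeries.coeff_zero_eq_constantCoeff_apply, hqE_def]
    exact EisensteinSeries.E_qExpansion_coeff_zero _ hpeven
  have hqE0' : PowerSeries.constantCoeff qE ≠ 0 := by rw [hqE0]; exact one_ne_zero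
  -- `p`-adic avatars
  set e : PowerSeries (PadicAlgCl p) := PowerSeries.map j qE with he_def
  set e' : PowerSeries (PadicAlgCl p) := PowerSeries.map j qE⁻¹ with he'_def
  set a : ℕ → PowerSeries (PadicAlgCl p) := fun i ↦ PowerSeries.map j (c i) with ha_def
  have he0 : PowerSeries.constantCoeff e = 1 := by
    rw [he_def, ← PowerSeries.coeff_zero_eq_constantCoeff_apply, PowerSeries.coeff_map,
      PowerSeries.coeff_zero_eq_constantCoeff_apply, hqE0, map_one]
  have hee' : e * e' = 1 := by
    rw [he_def, he'_def, ← map_mul, PowerSeries.mul_inv_cancel qE hqE0', map_one]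
  have he'inv : e' = e⁻¹ := by
    rw [PowerSeries.eq_inv_iff_mul_eq_one (by rw [he0]; exact one_ne_zero), mul_comm]
    exact hee'
  have he_int : ∀ n, ‖PowerSeries.coeff n e‖ ≤ 1 := fun n ↦ by
    rw [he_def, PowerSeries.coeff_map, hj]
    exact hE n
  have he'_int : ∀ n, ‖PowerSeries.coeff n e'‖ ≤ 1 := by
    rw [he'inv]
    exact hinv e he0 he_int
  have he'pow : ∀ s n, ‖PowerSeries.coeff n (e' ^ s)‖ ≤ 1 := fun s n ↦
    CapacityClassicality.norm_coeff_pow_le_one he'_int s n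
  have ha_bd : ∀ i n, ‖PowerSeries.coeff n (a i)‖ ≤ C * (p : ℝ) ^ (-(r * i)) := fun i n ↦ by
    rw [ha_def]
    dsimp only
    rw [PowerSeries.coeff_map, hj]
    exact hbound i n
  -- the summands of the Katz expansion, read `p`-adically
  have hg' : ∀ n, HasSum (fun i : ℕ ↦ PowerSeries.coeff n (a i * e' ^ i)) (g n) := by
    intro n
    convert hg n using 1
    funext i
    rw [← hj, ← PowerSeries.coeff_map, map_mul (PowerSeries.map j), map_pow (PowerSeries.map j)]
  -- Step A: `G := Σ g_n qⁿ`; coefficientwise `G · e^M = Σ_i (a_i e'^i) e^M`.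
  set G : PowerSeries (PadicAlgCl p) := PowerSeries.mk g with hG_def
  have hA : ∀ n, HasSum (fun i : ℕ ↦ PowerSeries.coeff n (a i * e' ^ i * e ^ M))
      (PowerSeries.coeff n (G * e ^ M)) := by
    intro n
    have hsum : ∀ x ∈ Finset.HasAntidiagonal.antidiagonal n, HasSum
        (fun i : ℕ ↦ PowerSeries.coeff x.1 (a i * e' ^ i) * PowerSeries.coeff x.2 (e ^ M))
        (g x.1 * PowerSeries.coeff x.2 (e ^ M)) := fun x _ ↦ (hg' x.1).mul_right _
    have key : ∀ i : ℕ, PowerSeries.coeff n (a i * e' ^ i * e ^ M) =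
        ∑ x ∈ Finset.HasAntidiagonal.antidiagonal n,
          PowerSeries.coeff x.1 (a i * e' ^ i) * PowerSeries.coeff x.2 (e ^ M) :=
      fun i ↦ PowerSeries.coeff_mul n _ _
    have hGsum : PowerSeries.coeff n (G * e ^ M) =
        ∑ x ∈ Finset.HasAntidiagonal.antidiagonal n, g x.1 * PowerSeries.coeff x.2 (e ^ M) := by
      rw [PowerSeries.coeff_mul]
      exact Finset.sum_congr rfl fun x _ ↦ by rw [hG_def, PowerSeries.coeff_mk]
    rw [hGsum]
    simp_rw [key]
    exact hasSum_sum hsum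
  -- Step B: split the Katz expansion at `i = M`: `G e^M = T_M + tail` coefficientwise.
  have hsplit_le : ∀ i ≤ M, a i * e' ^ i * e ^ M = a i * e ^ (M - i) := by
    intro i hi
    obtain ⟨d, rfl⟩ := Nat.exists_eq_add_of_le hi
    rw [Nat.add_sub_cancel_left, pow_add, mul_assoc, ← mul_assoc (e' ^ i), ← mul_pow,
      mul_comm e' e, hee', one_pow, one_mul]
  have hsplit_gt : ∀ jj : ℕ, a (jj + (M + 1)) * e' ^ (jj + (M + 1)) * e ^ M =
      a (jj + (M + 1)) * e' ^ (jj + 1) := by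
    intro jj
    rw [show jj + (M + 1) = (jj + 1) + M by ring, pow_add, mul_assoc, mul_assoc, ← mul_pow,
      mul_comm e' e, hee', one_pow, mul_one]
  obtain ⟨T, hT⟩ := htrunc c hc M
  have htM : ∀ n, ∑ i ∈ Finset.range (M + 1), PowerSeries.coeff n (a i * e ^ (M - i)) =
      ι.symm (PowerSeries.coeff n (UpperHalfPlane.qExpansion 1 ⇑T)) := by
    intro n
    rw [← hj, ← PowerSeries.coeff_map, hT, map_sum, map_sum]
    refine Finset.sum_congr rfl fun i _ ↦ ?_
    rw [map_mul (PowerSeries.map j), map_pow (PowerSeries.map j)]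
  have hB : ∀ n, HasSum (fun jj : ℕ ↦ PowerSeries.coeff n (a (jj + (M + 1)) * e' ^ (jj + 1)))
      (PowerSeries.coeff n (G * e ^ M) -
        ι.symm (PowerSeries.coeff n (UpperHalfPlane.qExpansion 1 ⇑T))) := by
    intro n
    have h1 := (hasSum_nat_add_iff' (M + 1)).mpr (hA n)
    have h2 : ∑ i ∈ Finset.range (M + 1), PowerSeries.coeff n (a i * e' ^ i * e ^ M) =
        ∑ i ∈ Finset.range (M + 1), PowerSeries.coeff n (a i * e ^ (M - i)) :=
      Finset.sum_congr rfl fun i hi ↦ by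
        rw [hsplit_le i (Nat.lt_succ_iff.mp (Finset.mem_range.mp hi))]
    rw [h2, htM n] at h1
    simp_rw [hsplit_gt] at h1
    exact h1
  -- Step C: the tail is small: `‖tail_n‖ ≤ C p^{-r(M+1)}` (ultrametric `tsum` bound).
  have hp1 : (1 : ℝ) ≤ p := by exact_mod_cast (Fact.out : p.Prime).one_lt.le
  have hCn : ∀ n, ‖PowerSeries.coeff n (G * e ^ M) -
      ι.symm (PowerSeries.coeff n (UpperHalfPlane.qExpansion 1 ⇑T))‖ ≤
        C * (p : ℝ) ^ (-(r * (M + 1 : ℕ))) := by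
    intro n
    rw [← (hB n).tsum_eq]
    refine IsUltrametricDist.norm_tsum_le_of_forall_le_of_nonneg (by positivity) fun jj ↦ ?_
    calc ‖PowerSeries.coeff n (a (jj + (M + 1)) * e' ^ (jj + 1))‖
        ≤ C * (p : ℝ) ^ (-(r * (jj + (M + 1) : ℕ))) * 1 :=
          hmul _ _ _ _ (by positivity) zero_le_one (ha_bd _) (he'pow _) n
      _ ≤ C * (p : ℝ) ^ (-(r * (M + 1 : ℕ))) := by
          rw [mul_one]
          refine mul_le_mul_of_nonneg_left (Real.rpow_le_rpow_of_exponent_le hp1 ?_) hC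
          have : (r * (M + 1 : ℕ) : ℝ) ≤ r * (jj + (M + 1) : ℕ) := by
            refine mul_le_mul_of_nonneg_left ?_ hr.le
            exact_mod_cast Nat.le_add_left (M + 1) jj
          linarith
  -- Step D: below order `m` the product `G e^M` has vanishing coefficients.
  have hD : ∀ n < m, PowerSeries.coeff n (G * e ^ M) = 0 := by
    intro n hn
    rw [PowerSeries.coeff_mul]
    refine Finset.sum_eq_zero fun x hx ↦ ?_
    have hx' := Finset.HasAntidiagonal.mem_antidiagonal.mp hx
    rw [hG_def, PowerSeries.coeff_mk, hvan x.1 (by omega), zero_mul]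
  -- Step E: integral Sturm applied to the classical truncation `T`.
  have hTsmall : ∀ n, ‖ι.symm (PowerSeries.coeff n (UpperHalfPlane.qExpansion 1 ⇑T))‖ ≤
      C * (p : ℝ) ^ (-(r * (M + 1 : ℕ))) := by
    refine hSturm _ T _ (by positivity) fun n hn ↦ ?_
    have hnm : n < m := lt_of_lt_of_le hn hline
    have := hCn n
    rwa [hD n hnm, zero_sub, norm_neg] at this
  -- Step F: `g_m = (G e^M)_m = tail_m + T_m`.
  have hF : PowerSeries.coeff m (G * e ^ M) = g m := by
    rw [PowerSeries.coeff_mul, Finset.sum_eq_single (m, 0)]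
    · rw [hG_def, PowerSeries.coeff_mk, PowerSeries.coeff_zero_eq_constantCoeff_apply, map_pow,
        he0, one_pow, mul_one]
    · intro x hx hne
      have hx' := Finset.HasAntidiagonal.mem_antidiagonal.mp hx
      have hx1 : x.1 < m := by
        rcases Nat.lt_or_ge x.1 m with h | h
        · exact h
        · exfalso
          apply hne
          have h1 : x.1 = m := by omega
          have h2 : x.2 = 0 := by omega
          exact Prod.ext h1 h2
      rw [hG_def, PowerSeries.coeff_mk, hvan x.1 hx1, zero_mul]
    · intro h
      exact absurd (Finset.HasAntidiagonal.mem_antidiagonal.mpr (by simp)) h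
  rw [← hF, ← sub_add_cancel (PowerSeries.coeff m (G * e ^ M))
    (ι.symm (PowerSeries.coeff m (UpperHalfPlane.qExpansion 1 ⇑T)))]
  exact (IsUltrametricDist.norm_add_le_max _ _).trans (max_le (hCn m) (hTsmall m))


/-- **Registered shape of stub 9 (`stub_shadowMainGeneral`) of line `Sketch-ideate-r1-k1`** — the
statement of `sturmSchwarzShadow_of_sturmLine` with all data universally quantified, verbatim as
registered in the skeleton `Cruxes/HilbertIntegralOverconvergentIsCongruence/Lines/Sketch_ideate_r1_k1.lean`. -/
theorem stub_shadowMainGeneral :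
    ∀ (p : ℕ) [Fact p.Prime] (hp : 5 ≤ p) (N : ℕ) [NeZero N] (k : ℤ) (ι : PadicAlgCl p ≃+* ℂ)
      (L : ℤ → ℕ),
      (∀ (k' : ℤ) (F : ModularForm (CongruenceSubgroup.Gamma1 N) k') (B : ℝ), 0 ≤ B →
        (∀ n : ℕ, n < L k' →
          ‖ι.symm (PowerSeries.coeff n (UpperHalfPlane.qExpansion 1 ⇑F))‖ ≤ B) →
        ∀ n : ℕ, ‖ι.symm (PowerSeries.coeff n (UpperHalfPlane.qExpansion 1 ⇑F))‖ ≤ B) →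
      (∀ n : ℕ, ‖ι.symm (PowerSeries.coeff n
        (UpperHalfPlane.qExpansion 1 ⇑(ModularForm.E (show 3 ≤ p - 1 by omega))))‖ ≤ 1) →
      (∀ (φ ψ : PowerSeries (PadicAlgCl p)) (A B : ℝ), 0 ≤ A → 0 ≤ B →
        (∀ n, ‖PowerSeries.coeff n φ‖ ≤ A) → (∀ n, ‖PowerSeries.coeff n ψ‖ ≤ B) →
        ∀ n, ‖PowerSeries.coeff n (φ * ψ)‖ ≤ A * B) →
      (∀ (φ : PowerSeries (PadicAlgCl p)),
        PowerSeries.constantCoeff φ = 1 → (∀ n, ‖PowerSeries.coeff n φ‖ ≤ 1) →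
        ∀ n : ℕ, ‖PowerSeries.coeff n φ⁻¹‖ ≤ 1) →
      (∀ (c : ℕ → PowerSeries ℂ),
        (∀ i : ℕ, ∃ F : ModularForm (CongruenceSubgroup.Gamma1 N) (k + i * (p - 1 : ℕ)),
          c i = UpperHalfPlane.qExpansion 1 ⇑F) →
        ∀ M : ℕ, ∃ T : ModularForm (CongruenceSubgroup.Gamma1 N) (k + M * (p - 1 : ℕ)),
          UpperHalfPlane.qExpansion 1 ⇑T = ∑ i ∈ Finset.range (M + 1),
            c i * (UpperHalfPlane.qExpansion 1 ⇑(ModularForm.E (show 3 ≤ p - 1 by omega))) ^ (M - i)) →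
      ∀ (r C : ℝ) (c : ℕ → PowerSeries ℂ), 0 < r → 0 ≤ C →
      (∀ i : ℕ, ∃ F : ModularForm (CongruenceSubgroup.Gamma1 N) (k + i * (p - 1 : ℕ)),
          c i = UpperHalfPlane.qExpansion 1 ⇑F) →
      (∀ i n : ℕ, ‖ι.symm (PowerSeries.coeff n (c i))‖ ≤ C * (p : ℝ) ^ (-(r * i))) →
      ∀ (g : ℕ → PadicAlgCl p),
      (∀ n : ℕ, HasSum (fun i : ℕ ↦ ι.symm (PowerSeries.coeff n (c i *
          ((UpperHalfPlane.qExpansion 1 ⇑(ModularForm.E (show 3 ≤ p - 1 by omega)))⁻¹) ^ i)))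
          (g n)) →
      ∀ (m M : ℕ), (∀ n < m, g n = 0) → L (k + M * (p - 1 : ℕ)) ≤ m →
        ‖g m‖ ≤ C * (p : ℝ) ^ (-(r * (M + 1 : ℕ))) :=
  fun p _ hp N _ k ι L hSturm hE hmul hinv htrunc r C c hr hC hc hbound g hg m M hvan hline ↦
    sturmSchwarzShadow_of_sturmLine p hp N k ι L hSturm hE hmul hinv htrunc r C c hr hC hc hbound g
      hg m M hvan hline

end Summit.Langlands.Langlands.Theorems.HilbertIntegralOverconvergentIsCongruence

end
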